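import Literature.Probability.RandomPlanarGeometry.SAWCountZdSymbolLeadingCoefficient
import Mathlib.Analysis.Polynomial.Basic
import HarnessLib

/-!
# Leading asymptotics of the bad-word census: `#T_j(n) / (2^n n^{2j−3}) → 2^{−j}/(j−2)!` for every `j ≥ 2`

Topic `Literature/Probability/RandomPlanarGeometry` (car λ «LEADING SHAPE COEFFICIENT», corollary file λ5; on `SAWCountZdSymbolLeadingCoefficient.lean` (a-p1 g25:
★★★ `coeff_symbolPoly_two_mul_sub_three`, `natDegree_symbolPoly`), `SAWCountZdSymbolPolynomiality.lean` (a-p1 g22: `badSlice`, ★★★ `card_badSlice_eq_pow_mul_eval`) and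
Mathlib's `Polynomial.isEquivalent_atTop_lead`).

PRINTED CONTEXT (locators only; nothing is quoted digit-for-digit). Madras–Slade (1993) §1.1 eq. (1.1.8) p. 5 (the `1/d` expansion of `μ`), Definition 1.2.4,
§1.2 p. 10; Clisby–Liang–Slade (2007) §3.3 eqs. (29)/(31). NOT IN PRINT as far as the lane's desks could locate: the statement below (a lane theorem about
the lane's census `T_j(n)` = canonical reversal-free step words of length `n` with `n − j` axes and a repeat — the count behind the `j`-th `1/d`-symbol of
`c_n(ℤ^d)`).

THIS FILE (lane «pcv-sawmu», a-p1 g25; all PROVED, standard axioms): `symbolPolyR` (`R_j ⊗ ℝ`, tool notion), `natDegree_symbolPolyR`, `leadingCoeff_symbolPolyR`,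
`card_badSlice_eq_pow_mul_evalR`, ★★★ `tendsto_card_badSlice_div`: for every `j ≥ 2`,
`#T_j(n) / (2^n · n^{2j−3}) → (1/2)^j / (j−2)!` as `n → ∞` — the number of bad words of excess `j` is `2^n n^{2j−3} (2^{−j}/(j−2)! + o(1))`.
[cite: MadrasSlade1993, §1.1 eq. (1.1.8) p. 5; Definition 1.2.4; §1.2 (p. 10)] [cite: ClisbyLiangSlade2007, §3.3 eqs. (29)/(31)]

Provenance: lane «pcv-sawmu», a-p1 g25 (2026-08-28).
-/

open Filter Topology Asymptotics
open Literature.Probability.LatticeModels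
open Literature.Probability.RandomPlanarGeometry.SAW
open Literature.Probability.Percolation

namespace Literature.Probability.RandomPlanarGeometry.SAW.Zd

namespace WordTypes

/-- The real symbol polynomial `R_j ⊗ ℝ`. [cite: MadrasSlade1993, §1.1 eq. (1.1.8) p. 5; lane tool notion] -/
noncomputable def symbolPolyR (j : ℕ) : Polynomial ℝ := (symbolPoly j).map (algebraMap ℚ ℝ)

/-- Degree over `ℝ`. [cite: MadrasSlade1993, §1.1 eq. (1.1.8) p. 5; lane plumbing] -/
theorem natDegree_symbolPolyR (j : ℕ) (hj : 2 ≤ j) : (symbolPolyR j).natDegree = 2 * j - 3 := by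
  unfold symbolPolyR
  rw [Polynomial.natDegree_map_eq_of_injective (algebraMap ℚ ℝ).injective, natDegree_symbolPoly j hj]

/-- Leading coefficient over `ℝ`. [cite: MadrasSlade1993, §1.1 eq. (1.1.8) p. 5; lane plumbing] -/
theorem leadingCoeff_symbolPolyR (j : ℕ) (hj : 2 ≤ j) :
    (symbolPolyR j).leadingCoeff = (1 / 2) ^ j / ((j - 2).factorial : ℝ) := by
  unfold symbolPolyR
  rw [Polynomial.leadingCoeff_map_of_injective (algebraMap ℚ ℝ).injective, Polynomial.leadingCoeff,
    natDegree_symbolPoly j hj, coeff_symbolPoly_two_mul_sub_three j hj, eq_ratCast]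
  push_cast
  ring

/-- `#T_j(n) = 2^n · R_j(n)` over `ℝ`, `n ≥ 2j − 1`. [cite: MadrasSlade1993, Definition 1.2.4; lane plumbing] -/
theorem card_badSlice_eq_pow_mul_evalR (j n : ℕ) (hn : 2 * j ≤ n + 1) :
    ((badSlice j n).card : ℝ) = 2 ^ n * (symbolPolyR j).eval (n : ℝ) := by
  have h := card_badSlice_eq_pow_mul_eval j n hn
  unfold symbolPolyR
  rw [Polynomial.eval_map, Polynomial.eval₂_at_natCast, eq_ratCast]
  exact_mod_cast h

/-- ★★★ LEADING ASYMPTOTICS OF THE BAD-WORD CENSUS: for every `j ≥ 2`,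
`#T_j(n) / (2^n · n^{2j−3}) → 2^{−j}/(j−2)!` as `n → ∞` — the canonical reversal-free words of length `n` with `n − j` axes and a repeat
number `2^n n^{2j−3} (2^{−j}/(j−2)! + o(1))`. [cite: MadrasSlade1993, §1.1 eq. (1.1.8) p. 5; Definition 1.2.4]
[cite: ClisbyLiangSlade2007, §3.3 eqs. (29)/(31); lane theorem] -/
theorem tendsto_card_badSlice_div (j : ℕ) (hj : 2 ≤ j) :
    Tendsto (fun n : ℕ => ((badSlice j n).card : ℝ) / (2 ^ n * (n : ℝ) ^ (2 * j - 3))) atTop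
      (𝓝 ((1 / 2) ^ j / ((j - 2).factorial : ℝ))) := by
  set c : ℝ := (1 / 2) ^ j / ((j - 2).factorial : ℝ) with hc
  have hc0 : c ≠ 0 := by rw [hc]; positivity
  have hdeg := natDegree_symbolPolyR j hj
  have hlc := leadingCoeff_symbolPolyR j hj
  -- `R_j(x) ~ c x^{2j−3}` as `x → ∞` in `ℝ`, composed with `n ↦ (n : ℝ)`
  have hequiv : (fun n : ℕ => (symbolPolyR j).eval (n : ℝ)) ~[atTop] fun n : ℕ => c * (n : ℝ) ^ (2 * j - 3) := by
    have h := (Polynomial.isEquivalent_atTop_lead (symbolPolyR j)).comp_tendsto tendsto_natCast_atTop_atTop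
    rw [hdeg, hlc] at h
    exact h
  have hv : ∀ᶠ n : ℕ in atTop, c * (n : ℝ) ^ (2 * j - 3) ≠ 0 := by
    filter_upwards [eventually_ge_atTop 1] with n hn
    exact mul_ne_zero hc0 (pow_ne_zero _ (by exact_mod_cast (show n ≠ 0 by omega)))
  have h1 : Tendsto (fun n : ℕ => (symbolPolyR j).eval (n : ℝ) / (c * (n : ℝ) ^ (2 * j - 3))) atTop (𝓝 1) :=
    (isEquivalent_iff_tendsto_one hv).1 hequiv
  have h2 : Tendsto (fun n : ℕ => (symbolPolyR j).eval (n : ℝ) / (c * (n : ℝ) ^ (2 * j - 3)) * c) atTop (𝓝 (1 * c)) :=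
    h1.mul_const c
  rw [one_mul] at h2
  refine h2.congr' ?_
  filter_upwards [eventually_ge_atTop (2 * j)] with n hn
  have hn0 : (n : ℝ) ^ (2 * j - 3) ≠ 0 := pow_ne_zero _ (by exact_mod_cast (show n ≠ 0 by omega))
  rw [card_badSlice_eq_pow_mul_evalR j n (by omega)]
  field_simp

end WordTypes

end Literature.Probability.RandomPlanarGeometry.SAW.Zd
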